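import Mathlib

/-!
# `GrenetZeon.DualUnipotentThreeHalves` (stmt-ValiantsHypothesis-24318), R2 `HeavyTopLaw` — IRREDUCIBLE NILPOTENT SPACES:
# `Irr(5,5)`, a `5`-dimensional irreducible nilpotent subspace of `M₅(ℂ)` (so `ι(5) ≥ 5`)

Experiment cell «val-heavytop-census» (D-0160, director-valiant b124 wave 2), engine seat val-htc-eng-2.  The open loci of the
small formats of R2 are governed by `ι(m)`, the maximal dimension of an IRREDUCIBLE linear space of nilpotent `m × m`
complex matrices (Mathes–Omladič–Radjavi, LAA 149 (1991) §5, open question); `Cruxes/DualUnipotentThreeHalves/INSTANCES.md`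
§7–§8 reduces `HeavyTopInst 4 6` to `ι(4) ≤ 3 ∧ ι(5) ≤ 7 ∧ ι(6) ≤ 11` and `HeavyTopInst 5 7` to `ι(7) ≤ 19`.  The companion
file `…HeavyTopIrreducibleData` certifies `ι(3) ≥ 2` (MOR's `Irr₃`) and `ι(4) ≥ 3` (`Irr(4,3)`).  For `m = 5` print offers
nothing beyond MOR's two-dimensional examples.  NEW DATUM (found by this seat's greedy search over signed two-entry
matrices, then checked exactly):

  `Irr(5,5) := span{J₅ = E₁₂+E₂₃+E₃₄+E₄₅, E₄₁−E₅₂, E₄₂−E₅₃, E₃₂−E₄₃, E₃₁−E₅₃} ⊂ M₅(ℂ)`.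

* `irrFive_nilpotent` — every member `sJ₅ + a(E₄₁−E₅₂) + b(E₄₂−E₅₃) + c(E₃₂−E₄₃) + d(E₃₁−E₅₃)` satisfies `M⁵ = 0`;
* `irrFive_irreducible` — a subspace of `ℂ⁵` invariant under the five generators is `0` or `ℂ⁵`
  (`J₅` pushes any non-zero vector to `e₁`; `(E₃₁−E₅₃)e₁ = e₃`, `(E₄₁−E₅₂)e₁ = e₄`, `J₅e₃ = e₂`, `(E₄₁−E₅₂)e₂ = −e₅`);
* `irrFive_independent` — the five generators are linearly independent (entries `(1,2),(4,1),(4,2),(3,2),(3,1)`).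

Hence **`ι(5) ≥ 5`**: the simple factors of size `5` in the composition bookkeeping of INSTANCES.md §8 can carry a block space
of dimension `5` (the bookkeeping there needs `≤ 7` for `(4,6)` and `≤ 8` for `(5,8)`, so this datum does not decide a cell;
it calibrates the engine and the conjectured growth of `ι`).  Matrices are literals (no definitions).  Honest framing: data for
the instrument; nothing here proves or refutes `HeavyTopLaw`, 24318, S3b or 8062; `VP ≠ VNP` is not moved. [this seat]
-/

noncomputable section

-- single-conjunct layout: Sub = Summit, duplicated namespace component intended
set_option linter.dupNamespace false

namespace Summit.ValiantsHypothesis.ValiantsHypothesis.Theorems.GrenetZeon.HeavyTopIrreducibleFive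

open Matrix

/-- Square of the generic member of `Irr(5,5)` (explicit). [this seat] -/
theorem irrFive_mul_one (s a b c d : ℂ) :
    (!![0, s, 0, 0, 0; 0, 0, s, 0, 0; d, c, 0, s, 0; a, b, -c, 0, s; 0, -a, -b - d, 0, 0] : Matrix (Fin 5) (Fin 5) ℂ) * (!![0, s, 0, 0, 0; 0, 0, s, 0, 0; d, c, 0, s, 0; a, b, -c, 0, s; 0, -a, -b - d, 0, 0] : Matrix (Fin 5) (Fin 5) ℂ) =
      (!![0, 0, s^2, 0, 0; s*d, s*c, 0, s^2, 0; s*a, s*d + s*b, 0, 0, s^2; -c*d, -c^2, -s*d, -s*c, 0; -d^2 - b*d, -c*d - b*c, -s*a, -s*d - s*b, 0] : Matrix (Fin 5) (Fin 5) ℂ) := by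
  ext i j
  fin_cases i <;> fin_cases j <;> simp [Matrix.mul_apply, Fin.sum_univ_five] <;> ring

/-- Cube of the generic member of `Irr(5,5)` (explicit; its third row vanishes). [this seat] -/
theorem irrFive_mul_two (s a b c d : ℂ) :
    (!![0, 0, s^2, 0, 0; s*d, s*c, 0, s^2, 0; s*a, s*d + s*b, 0, 0, s^2; -c*d, -c^2, -s*d, -s*c, 0; -d^2 - b*d, -c*d - b*c, -s*a, -s*d - s*b, 0] : Matrix (Fin 5) (Fin 5) ℂ) * (!![0, s, 0, 0, 0; 0, 0, s, 0, 0; d, c, 0, s, 0; a, b, -c, 0, s; 0, -a, -b - d, 0, 0] : Matrix (Fin 5) (Fin 5) ℂ) =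
      (!![s^2*d, s^2*c, 0, s^3, 0; s^2*a, s^2*d + s^2*b, 0, 0, s^3; 0, 0, 0, 0, 0; -s*d^2 - s*a*c, -2*s*c*d - s*b*c, 0, -s^2*d, -s^2*c; -2*s*a*d - s*a*b, -s*d^2 - 2*s*b*d - s*b^2 - s*a*c, 0, -s^2*a, -s^2*d - s^2*b] : Matrix (Fin 5) (Fin 5) ℂ) := by
  ext i j
  fin_cases i <;> fin_cases j <;> simp [Matrix.mul_apply, Fin.sum_univ_five] <;> ring

/-- Fourth power of the generic member of `Irr(5,5)` (explicit; rank `≤ 1` pattern `(s·col) ⊗ (row)`). [this seat] -/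
theorem irrFive_mul_three (s a b c d : ℂ) :
    (!![s^2*d, s^2*c, 0, s^3, 0; s^2*a, s^2*d + s^2*b, 0, 0, s^3; 0, 0, 0, 0, 0; -s*d^2 - s*a*c, -2*s*c*d - s*b*c, 0, -s^2*d, -s^2*c; -2*s*a*d - s*a*b, -s*d^2 - 2*s*b*d - s*b^2 - s*a*c, 0, -s^2*a, -s^2*d - s^2*b] : Matrix (Fin 5) (Fin 5) ℂ) * (!![0, s, 0, 0, 0; 0, 0, s, 0, 0; d, c, 0, s, 0; a, b, -c, 0, s; 0, -a, -b - d, 0, 0] : Matrix (Fin 5) (Fin 5) ℂ) =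
      (!![s^3*a, s^3*d + s^3*b, 0, 0, s^4; 0, 0, 0, 0, 0; 0, 0, 0, 0, 0; -s^2*a*d, -s^2*d^2 - s^2*b*d, 0, 0, -s^3*d; -s^2*a^2, -s^2*a*d - s^2*a*b, 0, 0, -s^3*a] : Matrix (Fin 5) (Fin 5) ℂ) := by
  ext i j
  fin_cases i <;> fin_cases j <;> simp [Matrix.mul_apply, Fin.sum_univ_five] <;> ring

/-- Fifth power of the generic member of `Irr(5,5)` vanishes. [this seat] -/
theorem irrFive_mul_four (s a b c d : ℂ) :
    (!![s^3*a, s^3*d + s^3*b, 0, 0, s^4; 0, 0, 0, 0, 0; 0, 0, 0, 0, 0; -s^2*a*d, -s^2*d^2 - s^2*b*d, 0, 0, -s^3*d; -s^2*a^2, -s^2*a*d - s^2*a*b, 0, 0, -s^3*a] : Matrix (Fin 5) (Fin 5) ℂ) * (!![0, s, 0, 0, 0; 0, 0, s, 0, 0; d, c, 0, s, 0; a, b, -c, 0, s; 0, -a, -b - d, 0, 0] : Matrix (Fin 5) (Fin 5) ℂ) = 0 := by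
  ext i j
  fin_cases i <;> fin_cases j <;> simp [Matrix.mul_apply, Fin.sum_univ_five] <;> ring

/-- Every member `sJ₅ + a(E₄₁−E₅₂) + b(E₄₂−E₅₃) + c(E₃₂−E₄₃) + d(E₃₁−E₅₃)` of `Irr(5,5)` is nilpotent: `M⁵ = 0`
(the generic member has nilindex exactly `5`: `(M⁴)₁₅ = s⁴`). [this seat] -/
theorem irrFive_nilpotent (s a b c d : ℂ) :
    (!![0, s, 0, 0, 0; 0, 0, s, 0, 0; d, c, 0, s, 0; a, b, -c, 0, s; 0, -a, -b - d, 0, 0] :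
      Matrix (Fin 5) (Fin 5) ℂ) ^ 5 = 0 := by
  rw [pow_succ, pow_succ, pow_succ, pow_succ, pow_one,
    irrFive_mul_one, irrFive_mul_two, irrFive_mul_three, irrFive_mul_four]

/-- **`Irr(5,5)` is irreducible**: a subspace of `ℂ⁵` invariant under `J₅`, `E₄₁−E₅₂`, `E₄₂−E₅₃`, `E₃₂−E₄₃`, `E₃₁−E₅₃`
is `0` or `ℂ⁵`.  (Only `J₅`, `R₁ = E₄₁−E₅₂` and `R₄ = E₃₁−E₅₃` are used: `J₅` pushes a non-zero vector to `e₁`,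
`R₄e₁ = e₃`, `R₁e₁ = e₄`, `J₅e₃ = e₂`, `R₁e₂ = −e₅`.) [this seat] -/
theorem irrFive_irreducible (U : Submodule ℂ (Fin 5 → ℂ))
    (hJ : ∀ u ∈ U, (!![0, 1, 0, 0, 0; 0, 0, 1, 0, 0; 0, 0, 0, 1, 0; 0, 0, 0, 0, 1; 0, 0, 0, 0, 0] :
      Matrix (Fin 5) (Fin 5) ℂ) *ᵥ u ∈ U)
    (hR1 : ∀ u ∈ U, (!![0, 0, 0, 0, 0; 0, 0, 0, 0, 0; 0, 0, 0, 0, 0; 1, 0, 0, 0, 0; 0, -1, 0, 0, 0] :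
      Matrix (Fin 5) (Fin 5) ℂ) *ᵥ u ∈ U)
    (hR4 : ∀ u ∈ U, (!![0, 0, 0, 0, 0; 0, 0, 0, 0, 0; 1, 0, 0, 0, 0; 0, 0, 0, 0, 0; 0, 0, -1, 0, 0] :
      Matrix (Fin 5) (Fin 5) ℂ) *ᵥ u ∈ U) :
    U = ⊥ ∨ U = ⊤ := by
  classical
  by_cases hU : U = ⊥
  · exact Or.inl hU
  right
  obtain ⟨u, huU, hu0⟩ := Submodule.exists_mem_ne_zero_of_ne_bot hU
  have hJv : ∀ v : Fin 5 → ℂ,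
      (!![0, 1, 0, 0, 0; 0, 0, 1, 0, 0; 0, 0, 0, 1, 0; 0, 0, 0, 0, 1; 0, 0, 0, 0, 0] :
        Matrix (Fin 5) (Fin 5) ℂ) *ᵥ v = ![v 1, v 2, v 3, v 4, 0] := by
    intro v; ext i; fin_cases i <;> simp [Matrix.mulVec, dotProduct, Fin.sum_univ_five]
  have hR1v : ∀ v : Fin 5 → ℂ,
      (!![0, 0, 0, 0, 0; 0, 0, 0, 0, 0; 0, 0, 0, 0, 0; 1, 0, 0, 0, 0; 0, -1, 0, 0, 0] :
        Matrix (Fin 5) (Fin 5) ℂ) *ᵥ v = ![0, 0, 0, v 0, -v 1] := by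
    intro v; ext i; fin_cases i <;> simp [Matrix.mulVec, dotProduct, Fin.sum_univ_five]
  have hR4v : ∀ v : Fin 5 → ℂ,
      (!![0, 0, 0, 0, 0; 0, 0, 0, 0, 0; 1, 0, 0, 0, 0; 0, 0, 0, 0, 0; 0, 0, -1, 0, 0] :
        Matrix (Fin 5) (Fin 5) ℂ) *ᵥ v = ![0, 0, v 0, 0, -v 2] := by
    intro v; ext i; fin_cases i <;> simp [Matrix.mulVec, dotProduct, Fin.sum_univ_five]
  -- the shifted vectors `J^k u`
  set w1 : Fin 5 → ℂ := ![u 1, u 2, u 3, u 4, 0] with hw1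
  set w2 : Fin 5 → ℂ := ![u 2, u 3, u 4, 0, 0] with hw2
  set w3 : Fin 5 → ℂ := ![u 3, u 4, 0, 0, 0] with hw3
  set w4 : Fin 5 → ℂ := ![u 4, 0, 0, 0, 0] with hw4
  have hw1U : w1 ∈ U := by have h := hJ _ huU; rwa [hJv] at h
  have hw2U : w2 ∈ U := by
    have h := hJ _ hw1U; rw [hJv] at h
    have : w2 = ![w1 1, w1 2, w1 3, w1 4, 0] := by ext i; fin_cases i <;> simp [hw1, hw2]
    rwa [this]
  have hw3U : w3 ∈ U := by
    have h := hJ _ hw2U; rw [hJv] at h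
    have : w3 = ![w2 1, w2 2, w2 3, w2 4, 0] := by ext i; fin_cases i <;> simp [hw2, hw3]
    rwa [this]
  have hw4U : w4 ∈ U := by
    have h := hJ _ hw3U; rw [hJv] at h
    have : w4 = ![w3 1, w3 2, w3 3, w3 4, 0] := by ext i; fin_cases i <;> simp [hw3, hw4]
    rwa [this]
  -- `e₀ ∈ U`: rescale the last non-zero shifted vector
  have he0 : (Pi.single 0 1 : Fin 5 → ℂ) ∈ U := by
    by_cases h4 : u 4 ≠ 0
    · have : (Pi.single 0 1 : Fin 5 → ℂ) = (u 4)⁻¹ • w4 := by ext i; fin_cases i <;> simp [hw4, h4]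
      rw [this]; exact U.smul_mem _ hw4U
    push Not at h4
    by_cases h3 : u 3 ≠ 0
    · have : (Pi.single 0 1 : Fin 5 → ℂ) = (u 3)⁻¹ • w3 := by ext i; fin_cases i <;> simp [hw3, h3, h4]
      rw [this]; exact U.smul_mem _ hw3U
    push Not at h3
    by_cases h2 : u 2 ≠ 0
    · have : (Pi.single 0 1 : Fin 5 → ℂ) = (u 2)⁻¹ • w2 := by ext i; fin_cases i <;> simp [hw2, h2, h3, h4]
      rw [this]; exact U.smul_mem _ hw2U
    push Not at h2
    by_cases h1 : u 1 ≠ 0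
    · have : (Pi.single 0 1 : Fin 5 → ℂ) = (u 1)⁻¹ • w1 := by ext i; fin_cases i <;> simp [hw1, h1, h2, h3, h4]
      rw [this]; exact U.smul_mem _ hw1U
    push Not at h1
    have h0 : u 0 ≠ 0 := by
      intro h0; apply hu0; ext i; fin_cases i <;> simp [h0, h1, h2, h3, h4]
    have : (Pi.single 0 1 : Fin 5 → ℂ) = (u 0)⁻¹ • u := by
      ext i; fin_cases i <;> simp [h0, h1, h2, h3, h4]
    rw [this]; exact U.smul_mem _ huU
  -- `e₂ = R₄ e₀`, `e₃ = R₁ e₀`, `e₁ = J e₂`, `e₄ = -R₁ e₁`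
  have he2 : (Pi.single 2 1 : Fin 5 → ℂ) ∈ U := by
    have h := hR4 _ he0
    rw [hR4v] at h
    have : (Pi.single 2 1 : Fin 5 → ℂ) =
        ![(0:ℂ), 0, (Pi.single (0 : Fin 5) (1:ℂ) : Fin 5 → ℂ) 0, 0, -(Pi.single (0 : Fin 5) (1:ℂ) : Fin 5 → ℂ) 2] := by
      ext i; fin_cases i <;> simp
    rw [this]; exact h
  have he3 : (Pi.single 3 1 : Fin 5 → ℂ) ∈ U := by
    have h := hR1 _ he0
    rw [hR1v] at h
    have : (Pi.single 3 1 : Fin 5 → ℂ) =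
        ![(0:ℂ), 0, 0, (Pi.single (0 : Fin 5) (1:ℂ) : Fin 5 → ℂ) 0, -(Pi.single (0 : Fin 5) (1:ℂ) : Fin 5 → ℂ) 1] := by
      ext i; fin_cases i <;> simp
    rw [this]; exact h
  have he1 : (Pi.single 1 1 : Fin 5 → ℂ) ∈ U := by
    have h := hJ _ he2
    rw [hJv] at h
    have : (Pi.single 1 1 : Fin 5 → ℂ) =
        ![(Pi.single (2 : Fin 5) (1:ℂ) : Fin 5 → ℂ) 1, (Pi.single (2 : Fin 5) (1:ℂ) : Fin 5 → ℂ) 2,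
          (Pi.single (2 : Fin 5) (1:ℂ) : Fin 5 → ℂ) 3, (Pi.single (2 : Fin 5) (1:ℂ) : Fin 5 → ℂ) 4, 0] := by
      ext i; fin_cases i <;> simp
    rw [this]; exact h
  have he4 : (Pi.single 4 1 : Fin 5 → ℂ) ∈ U := by
    have h := hR1 _ he1
    rw [hR1v] at h
    have : (Pi.single 4 1 : Fin 5 → ℂ) = (-1 : ℂ) •
        ![(0:ℂ), 0, 0, (Pi.single (1 : Fin 5) (1:ℂ) : Fin 5 → ℂ) 0, -(Pi.single (1 : Fin 5) (1:ℂ) : Fin 5 → ℂ) 1] := by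
      ext i; fin_cases i <;> simp
    rw [this]; exact U.smul_mem _ h
  refine Submodule.eq_top_iff'.2 fun v => ?_
  have hv : v = v 0 • (Pi.single 0 1 : Fin 5 → ℂ) + v 1 • (Pi.single 1 1 : Fin 5 → ℂ) +
      v 2 • (Pi.single 2 1 : Fin 5 → ℂ) + v 3 • (Pi.single 3 1 : Fin 5 → ℂ) + v 4 • (Pi.single 4 1 : Fin 5 → ℂ) := by
    ext i; fin_cases i <;> simp
  rw [hv]
  exact U.add_mem (U.add_mem (U.add_mem (U.add_mem (U.smul_mem _ he0) (U.smul_mem _ he1)) (U.smul_mem _ he2))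
    (U.smul_mem _ he3)) (U.smul_mem _ he4)

/-- The five generators of `Irr(5,5)` are linearly independent (read off the entries `(1,2)`, `(4,1)`, `(4,2)`, `(3,2)`,
`(3,1)`), so `dim Irr(5,5) = 5` and **`ι(5) ≥ 5`**. [this seat] -/
theorem irrFive_independent (s a b c d : ℂ)
    (h : (!![0, s, 0, 0, 0; 0, 0, s, 0, 0; d, c, 0, s, 0; a, b, -c, 0, s; 0, -a, -b - d, 0, 0] :
      Matrix (Fin 5) (Fin 5) ℂ) = 0) :
    s = 0 ∧ a = 0 ∧ b = 0 ∧ c = 0 ∧ d = 0 := by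
  have h1 := congr_fun (congr_fun h 0) 1
  have h2 := congr_fun (congr_fun h 3) 0
  have h3 := congr_fun (congr_fun h 3) 1
  have h4 := congr_fun (congr_fun h 2) 1
  have h5 := congr_fun (congr_fun h 2) 0
  simp at h1 h2 h3 h4 h5
  exact ⟨h1, h2, h3, h4, h5⟩

end Summit.ValiantsHypothesis.ValiantsHypothesis.Theorems.GrenetZeon.HeavyTopIrreducibleFive

end
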